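import Summits.BirchSwinnertonDyer.BirchSwinnertonDyer.Theorems.ManinLocalTwoThreePinningKernelFricke
import HarnessLib

/-!
# PINNING KERNEL, part E: the Fricke sieve with a GENERAL (rational) Fricke MATRIX — for levels whose holomorphic
# `η`-basis of `M₂(Γ₀(N))` cannot be chosen `σ`-closed

Cell bsd-f2-manin, route `ManinLocalTwoThree` (crux C2 `ManinOddAtFour` stmt-22967, C3 `ManinPrimeToThreeAtNine` stmt-22968), prover seat p2
gen 30; `--supports` (helper), generic, def-free.  Part C (`…PinningKernelFricke`, an g54) kills old sieve survivors by the Fricke rows of a pinned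
newform WHEN the certified `η`-basis `C₀,…,C_{g−1}` is closed under the Fricke reflection `σ : r ↦ (δ ↦ r(N/δ))`, so that `w_N` is a signed
scalar permutation.  At `N = 96` (and other levels) NO `σ`-closed holomorphic `η`-basis exists (the trace of `w_N` on `M₂(Γ₀(96))` is `−4`, while a
`σ`-closed `η`-basis forces trace `= −#(σ-fixed members)` with every pair contributing `0` — measured: 3000 randomized greedy completions fail).
This part removes the hypothesis:

* §E1 `slash_eq_sum_of_imageCoords`: if the Fricke image `∏ η(δτ)^{r_i(N/δ)}` of each basis quotient is (the function of) a certified form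
  `G i ∈ M₂(Γ₀(N))` with coordinates `G i = Σ_j x_ij • C_j` on the basis (in the level files: by dual separation `eq_of_dual` on kernel
  tables), then `⇑(C i) ∣₂ w_N = Σ_j (−Kᵢ·x_ij) • ⇑(C j)` (`Kᵢ = numᵢ/denᵢ` the certified Fricke constant of part C);
* §E2 `frickeMatrixRows_of_pinning`: for ANY matrix `Φ` with `⇑(C i) ∣₂ w_N = Σ_j Φ j i • ⇑(C j)` and an integer presentation
  `Φ j i · Φd = Φn j i`, a pinned newform `d' • D.f = Σ_j y_j • C_j` has integer coordinates satisfying the matrix Fricke rows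
  `Σ_i Φn j i · y_i = ε·Φd·y_j` for `ε = 1` or `ε = −1` (tree `fricke_coords`: `D.f ∣ w_N = ±D.f` for a newform) — a DECIDABLE test that
  kills the old candidates.
HONEST FRAMING: generic linear algebra over the tree's `fricke_coords`; nothing here proves C2/C3, Manin's conjecture or BSD.
[cite: AtkinLehner1970, Thm. 3] [cite: Koehler2011, §2.4] [cite: CremonaAlgorithms1997, §2.10]
-/

set_option autoImplicit false
-- lint-debt: the directory name repeats the summit name (sibling precedent `ManinLocalTwoThreePinningKernelFricke.lean`)
set_option linter.dupNamespace false

noncomputable section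

open Complex
open UpperHalfPlane hiding I
open scoped MatrixGroups ModularForm
open ModularForm CongruenceSubgroup
open Literature.NumberTheory.ModularForms
open Literature.NumberTheory.EllipticCurves Literature.NumberTheory.EllipticCurves.ModularForms

namespace Summit.BirchSwinnertonDyer.BirchSwinnertonDyer.Theorems.ManinLocalTwoThree.PinningKernel

open Summit.BirchSwinnertonDyer.BirchSwinnertonDyer.Theorems.ManinLocalTwoThree.BracketSturm
open Summit.BirchSwinnertonDyer.BirchSwinnertonDyer.Theorems.ManinLocalTwoThree.EtaFricke
open Summit.BirchSwinnertonDyer.BirchSwinnertonDyer.Theorems.ManinLocalTwoThree.LevelFiftyTwo (fricke_coords)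

/-! ## §E1 `w_N` on a certified `η`-family whose Fricke images are expressed on the family -/

section ImageCoords

variable {N : ℕ} [NeZero N] {g : ℕ} (C : Fin g → ModularForm (Gamma0 N) 2) (r : Fin g → ℕ → ℤ)
  (hC : ∀ i, ∀ τ : ℍ, C i τ = etaQuotient N (r i) τ)
  (G : Fin g → ModularForm (Gamma0 N) 2) (rI : Fin g → ℕ → ℤ) (hG : ∀ i, ∀ τ : ℍ, G i τ = etaQuotient N (rI i) τ)
  (num den : Fin g → ℕ)
  (hsum : ∀ i, ∑ δ ∈ N.divisors, r i δ = 4)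
  (hsig : ∀ i, ∀ δ ∈ N.divisors, frickeExp N (r i) δ = rI i δ)
  (hK : ∀ i, 0 < num i ∧ 0 < den i ∧ num i ^ 2 * posPart N (r i) = N ^ 2 * den i ^ 2 * negPart N (r i))
  (x : Fin g → Fin g → ℂ) (himg : ∀ i, G i = ∑ j, x i j • C j)

include hC hG hsum hsig hK himg in
/-- **`w_N` as a MATRIX on a certified `η`-family**: if the Fricke image of `C i` is the certified form `G i = Σ_j x_ij • C_j`, then
`⇑(C i) ∣₂ w_N = Σ_j (−(numᵢ/denᵢ)·x_ij) • ⇑(C j)`. [cite: AtkinLehner1970, Thm. 3] [cite: Koehler2011, §2.4] -/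
theorem slash_eq_sum_of_imageCoords (i : Fin g) :
    (⇑(C i) : ℍ → ℂ) ∣[(2 : ℤ)] (glCast (frickeGL N : GL (Fin 2) ℚ) : GL (Fin 2) ℝ) =
      ∑ j, (-(((num i : ℝ) / den i : ℝ) : ℂ) * x i j) • (⇑(C j) : ℍ → ℂ) := by
  obtain ⟨hn, hd, hcert⟩ := hK i
  rw [show (⇑(C i) : ℍ → ℂ) = etaQuotient N (r i) from funext (hC i),
    etaQuotient_slash_frickeGL N (r i) (hsum i), etaFrickeConst_eq_of_natCert N (r i) (hsum i) (num i) (den i) hn hd hcert,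
    etaQuotient_congr N (hsig i), show etaQuotient N (rI i) = (⇑(G i) : ℍ → ℂ) from (funext (hG i)).symm, himg i, coe_sum_smul,
    Finset.smul_sum]
  exact Finset.sum_congr rfl fun j _ ↦ by rw [smul_smul]

end ImageCoords

/-! ## §E2 The matrix Fricke rows of a pinned newform -/

section MatrixRows

variable {N : ℕ} [NeZero N] {W : WeierstrassCurve ℚ} (D : ModularParametrizationData W N)
  {g : ℕ} (C : Fin g → ModularForm (Gamma0 N) 2) (hli : LinearIndependent ℂ C)
  (Φ : Fin g → Fin g → ℂ) (Φn : Fin g → Fin g → ℤ) (Φd : ℕ) (hΦd : 0 < Φd)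
  (hΦ : ∀ j i, Φ j i * (Φd : ℂ) = ((Φn j i : ℤ) : ℂ))
  (hW : ∀ i, (⇑(C i) : ℍ → ℂ) ∣[(2 : ℤ)] (glCast (frickeGL N : GL (Fin 2) ℚ) : GL (Fin 2) ℝ) = ∑ j, Φ j i • (⇑(C j) : ℍ → ℂ))

include hli hΦd hΦ hW in
/-- **THE MATRIX FRICKE ROWS OF A PINNED NEWFORM.**  If `d' • D.f = Σ_j y_j • C_j` in `M₂(Γ₀(N))` (`d' ≠ 0`) and `w_N` acts on the basis by
the matrix `Φ = Φn/Φd`, then `Σ_i Φn j i · y_i = Φd · y_j` for all `j`, or `Σ_i Φn j i · y_i = −Φd · y_j` for all `j` (the newform is a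
`w_N`-eigenvector with eigenvalue `±1`). [cite: AtkinLehner1970, Thm. 3] -/
theorem frickeMatrixRows_of_pinning {d' : ℤ} (hd' : d' ≠ 0) (ys : List ℤ)
    (hpin : ((d' : ℤ) : ℂ) • ModularFormClass.modularForm D.f = ∑ j : Fin g, ((ys.getD (j : ℕ) 0 : ℤ) : ℂ) • C j) :
    (∀ j : Fin g, ∑ i : Fin g, Φn j i * ys.getD (i : ℕ) 0 = Φd * ys.getD (j : ℕ) 0) ∨
    (∀ j : Fin g, ∑ i : Fin g, Φn j i * ys.getD (i : ℕ) 0 = -(Φd * ys.getD (j : ℕ) 0)) := by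
  set x : Fin g → ℂ := fun j ↦ ((ys.getD (j : ℕ) 0 : ℤ) : ℂ) / d' with hx
  have hd'C : ((d' : ℤ) : ℂ) ≠ 0 := Int.cast_ne_zero.mpr hd'
  have hΦdC : ((Φd : ℕ) : ℂ) ≠ 0 := by exact_mod_cast hΦd.ne'
  have hf : (⇑D.f : ℍ → ℂ) = ∑ i, x i • (⇑(C i) : ℍ → ℂ) := by
    have h1 : (ModularFormClass.modularForm D.f : ModularForm (Gamma0 N) 2) = ∑ j, x j • C j := by
      have h2 := congrArg (fun G : ModularForm (Gamma0 N) 2 ↦ (((d' : ℤ) : ℂ)⁻¹) • G) hpin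
      simp only [smul_smul, inv_mul_cancel₀ hd'C, one_smul, Finset.smul_sum] at h2
      rw [h2]
      exact Finset.sum_congr rfl fun j _ ↦ by rw [hx]; simp only [div_eq_inv_mul]
    have h3 : (⇑D.f : ℍ → ℂ) = ⇑(∑ j, x j • C j : ModularForm (Gamma0 N) 2) := by rw [← h1]; rfl
    rw [h3, coe_sum_smul]
  obtain ⟨ε, hε, hrows⟩ := fricke_coords D (fun i ↦ (⇑(C i) : ℍ → ℂ)) (linearIndependent_coe C hli) x hf Φ hW
  have key : ∀ j, ((∑ i, Φn j i * ys.getD (i : ℕ) 0 : ℤ) : ℂ) = ε * (((Φd : ℕ) * ys.getD (j : ℕ) 0 : ℤ) : ℂ) := fun j ↦ by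
    have h := congrArg (fun z ↦ z * (((Φd : ℕ) : ℂ) * ((d' : ℤ) : ℂ))) (hrows j)
    simp only [Finset.sum_mul] at h
    have h3 : ∀ i, Φ j i * x i * (((Φd : ℕ) : ℂ) * ((d' : ℤ) : ℂ)) = ((Φn j i : ℤ) : ℂ) * ((ys.getD (i : ℕ) 0 : ℤ) : ℂ) := fun i ↦ by
      rw [← hΦ j i, hx]
      field_simp
    have h4 : ε * x j * (((Φd : ℕ) : ℂ) * ((d' : ℤ) : ℂ)) = ε * (((Φd : ℕ) : ℂ) * ((ys.getD (j : ℕ) 0 : ℤ) : ℂ)) := by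
      rw [hx]
      field_simp
    rw [Finset.sum_congr rfl fun i _ ↦ h3 i, h4] at h
    push_cast
    exact h
  rcases hε with rfl | rfl
  · refine Or.inl fun j ↦ ?_
    have h := key j
    rw [one_mul] at h
    exact_mod_cast h
  · refine Or.inr fun j ↦ ?_
    have h := key j
    rw [neg_one_mul, ← Int.cast_neg] at h
    exact_mod_cast h

end MatrixRows

end Summit.BirchSwinnertonDyer.BirchSwinnertonDyer.Theorems.ManinLocalTwoThree.PinningKernel

end
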